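import Summits.QuantumFields.YangMills.Theorems.FluctuationComparisonRegPrIntLS2BetaFlatTubeDepthOneUniformTorus
import HarnessLib

/-!
# CLOSE-PAIR IN `ℓ²`, ONE BLOCK LEVEL, VOLUME-UNIFORM — two comb-axial-related fields are `ℓ²`-close on the bonds of the torus in terms of the `ℓ²` mismatch of their
# one-step (0.4) averages and the `ℓ²` size of their plaquettes, with constants depending on `d, L` only
# (crux `FluctuationComparisonRegPrIntL`, stmt-QuantumFields-20520; registry v11.4 `Cruxes/FluctuationComparisonRegPrIntL/Lines/semiclassical_s2beta.lean` 3732b7df FROZEN, untouched)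

Cell `ym3-torus` (YM ladder rung R3 = continuum `SU(2)` Yang–Mills on the three-torus — a RUNG: NOT d = 4, NOT infinite volume, NOT a mass gap, NOT Clay).
Width seat `ym3-torus-px12` (gen 22); `--kind proof --supports stmt-QuantumFields-20520 --as helper`, count-neutral, DEFINITION-FREE (0 `def`, 0 `instance`,
0 `notation`, 0 `sorry`, default heartbeats).

WHY.  px8 g18's ✓`oneStepRooted₀_holds` ([Balaban1985RegularSpaces] Lemma 1, one block level) is a SUP statement: two fields with plaquettes `< α₀` EVERYWHERE and one-step
averages `α₁`-close EVERYWHERE are `(α₁ + C·α₀)`-close on every bond after a rooted gauge transformation.  The growth organs of LINE S2β measure the distance to a residual orbit in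
`ℓ²` (`Σ_ℓ dist1(…)²`), and a constant chosen before the run must not see the volume; the sup letters cannot deliver that.  This file is the `ℓ²` twin: with the LOCAL per-bond
bounds of ✓`…S2BetaOneStepLocalAxialBounds` ∕ ✓`…S2BetaOneStepLocalCrossingBounds`, every bond of `W·Y⁻¹` (`W` comb-axial relative to `Y`) is at most the (0.4)-mismatch at its
own coarse bond plus `C(d,L)·√(local plaquette square sum of W and Y)`; squaring and summing costs the block-ball multiplicity of ✓`…S2BetaFlatTubeDepthOneUniformTorus`.
The flat-datum growth letter (✓`…S2BetaFlatTubeDepthOneUniform`) is the case `Y = 1`, mismatch `0`.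

WHAT (one block level on the finest lattice of a torus `P`, `SU(N)`, `ℰ = expMeanLogSU`; `W` with the same `1`-block comb transporters as `Y`).
* §1 ★ `dist1_mul_inv_le_mismatch_add_local` — per bond: `dist1(W ℓ·Y ℓ⁻¹) ≤ dist1(W̄ c(ℓ)·Ȳ c(ℓ)⁻¹) + C(d,L)·√T_{B(ℓ)}`, `c(ℓ) = ⟨blockOf ℓ.src, ℓ.dir⟩`, `T_y = Σ_{tdist q.src (emb y) ≤ 2dL+L}
  (dist1(W(∂q))² + dist1(Y(∂q))²)`, provided `√T_y` is under the (0.4) guard; ★ `dist1_mul_inv_sq_le_local` — its square, `≤ 2·mismatch² + 2·C²·T_y`.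
* §2 `card_bonds_over_le` (at most `d(2dL+1)^d` fine bonds over a coarse bond — crude, volume-free); ★★ `sum_dist1_mul_inv_sq_le` —
  **`Σ_ℓ dist1(W ℓ·Y ℓ⁻¹)² ≤ 2d(2dL+1)^d·Σ_c dist1(W̄ c·Ȳ c⁻¹)² + 2C²M·Σ_q (dist1(W(∂q))² + dist1(Y(∂q))²)`**, constants in `d, L` only.

HONEST: lattice kinematics + Cauchy–Schwarz over landed letters; one block level only; nothing of Bałaban's analysis; CLOSE-PAIR∘ (sup, all depths) is px8's ✓`closePair_holds` and is
NOT re-proved here; TUBE-REG∘, GAP♯∘, EXW∘, S2β, crux 20520 NOT proved; no registered stub is closed; rung R3 = SU(2) YM₃ on T³ — NOT d = 4, NOT infinite volume, NOT a mass gap,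
NOT Clay; the Yang–Mills mass gap is NOT proved.  Sorry-free, axioms standard.

References: T. Bałaban, CMP **99** (1985) 75–102 [Balaban1985RegularSpaces] (Lemma 1 (1.24)–(1.26) pp.79–80); CMP **102** (1985) 255–275 [Balaban1985UV3] ((12)–(13) p.259);
CMP **96** (1984) 223–250 [Balaban1984PropagatorsII] ((1.33)).
-/

set_option autoImplicit false

noncomputable section

namespace Summit.QuantumFields.YangMills.Theorems.FluctuationComparisonRegPrIntLS2BetaOneStepL2ClosePair

open Finset
open Literature.MathematicalPhysics.QuantumFieldTheory.Balaban1983to89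
open T4Continuum BlockAveraging AveragingRT ExpMeanLog
open B10Eq27TorusAxialLog (axialT)
open B5Eq118OneStroke (iterBlockOf)
open B15DeterminingSets (embIter)
open B3Taylor310LocalRemainder (tdist_comm tdist_self tdist_triangle)
open Summit.QuantumFields.YangMills.Theorems.FluctuationComparisonRegPrIntLS2BetaDetRepLocalRows (card_filter_tdist_comp_le)
open Summit.QuantumFields.YangMills.Theorems.FluctuationComparisonRegPrIntLS2BetaOneStepLocalAxialBounds
open Summit.QuantumFields.YangMills.Theorems.FluctuationComparisonRegPrIntLS2BetaOneStepLocalCrossingBounds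
open Summit.QuantumFields.YangMills.Theorems.FluctuationComparisonRegPrIntLS2BetaFlatTubeDepthOneUniformTorus

open scoped Matrix.Norms.L2Operator

variable {P : Params} {n : Type*} [Fintype n] [DecidableEq n] [Nonempty n]

/-! ## §1 The per-bond bound: mismatch plus local plaquettes -/

/-- One term of the pair's local square sum bounds either field's plaquette there. [folklore] -/
theorem dist1_le_sqrt_pairSum {G : Type*} [GaugeGroup G] (W Y : GaugeField P 0 G) (c : Site P 0) (R : ℕ) (q : Plaq P 0)
    (hq : Site.tdist q.src c ≤ R) :
    dist1 (GaugeField.plaqHol W q) ≤ Real.sqrt (∑ q' ∈ univ.filter (fun q' : Plaq P 0 => Site.tdist q'.src c ≤ R),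
        (dist1 (GaugeField.plaqHol W q') ^ 2 + dist1 (GaugeField.plaqHol Y q') ^ 2)) ∧
      dist1 (GaugeField.plaqHol Y q) ≤ Real.sqrt (∑ q' ∈ univ.filter (fun q' : Plaq P 0 => Site.tdist q'.src c ≤ R),
        (dist1 (GaugeField.plaqHol W q') ^ 2 + dist1 (GaugeField.plaqHol Y q') ^ 2)) := by
  classical
  have hmem : q ∈ univ.filter (fun q' : Plaq P 0 => Site.tdist q'.src c ≤ R) := Finset.mem_filter.mpr ⟨Finset.mem_univ _, hq⟩
  have hle := Finset.single_le_sum (f := fun q' : Plaq P 0 => dist1 (GaugeField.plaqHol W q') ^ 2 + dist1 (GaugeField.plaqHol Y q') ^ 2)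
    (fun _ _ => add_nonneg (sq_nonneg _) (sq_nonneg _)) hmem
  have hS0 : 0 ≤ ∑ q' ∈ univ.filter (fun q' : Plaq P 0 => Site.tdist q'.src c ≤ R),
      (dist1 (GaugeField.plaqHol W q') ^ 2 + dist1 (GaugeField.plaqHol Y q') ^ 2) :=
    Finset.sum_nonneg fun _ _ => add_nonneg (sq_nonneg _) (sq_nonneg _)
  constructor
  · refine (Real.le_sqrt (GaugeGroup.dist1_nonneg _) hS0).mpr ?_
    have := sq_nonneg (dist1 (GaugeField.plaqHol Y q))
    linarith
  · refine (Real.le_sqrt (GaugeGroup.dist1_nonneg _) hS0).mpr ?_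
    have := sq_nonneg (dist1 (GaugeField.plaqHol W q))
    linarith

/-- ★ **PER BOND: MISMATCH PLUS LOCAL PLAQUETTES.**  `W` comb-axial relative to `Y`, bond `ℓ = ⟨x, μ⟩`, `y = blockOf x`, `T_y` the pair's plaquette square sum over the
ball `tdist q.src (emb y) ≤ 2dL + L`, `√T_y` under the (0.4) guard ⟹ `dist1(W ℓ·Y ℓ⁻¹) ≤ dist1(W̄⟨y,μ⟩·Ȳ⟨y,μ⟩⁻¹) + C(d,L)·√T_y` (interior bonds by
✓`dist1_mul_inv_le_interior_local`, crossing bonds by ✓`dist1_cross_le_local` with `α₁ :=` the mismatch at `⟨y, μ⟩`; ✓`le_mul_sqrt_of_forall`).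
[cite: Balaban1985RegularSpaces, Lemma 1 (1.24)-(1.26) pp.79-80; Balaban1987RG1, (0.4) p.253] -/
theorem dist1_mul_inv_le_mismatch_add_local (hk : 1 ≤ P.m + P.K) (W Y : GaugeField P 0 (Matrix.specialUnitaryGroup n ℂ))
    (hax : ∀ x : Site P 0, axialT W (embIter 1 (iterBlockOf 1 x)) x = axialT Y (embIter 1 (iterBlockOf 1 x)) x)
    (x : Site P 0) (μ : Fin P.d)
    (hT : Real.sqrt (∑ q ∈ univ.filter (fun q : Plaq P 0 => Site.tdist q.src (emb (iterBlockOf 1 x)) ≤ 2 * P.d * P.L + P.L),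
        (dist1 (GaugeField.plaqHol W q) ^ 2 + dist1 (GaugeField.plaqHol Y q) ^ 2)) < deltaSU n / ((((P.d + 2) * P.L : ℕ) : ℝ) ^ 2 / 4)) :
    dist1 (W ⟨x, μ⟩ * (Y ⟨x, μ⟩)⁻¹) ≤
      dist1 (avgFun (expMeanLogSU (n := n)) W ⟨iterBlockOf 1 x, μ⟩ * (avgFun (expMeanLogSU (n := n)) Y ⟨iterBlockOf 1 x, μ⟩)⁻¹) +
        (2 * ((P.d : ℝ) * (P.L : ℝ)) ^ 2 + 2 * (6 * ((((P.d + 2) * P.L : ℕ) : ℝ) ^ 2 / 4)) +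
            ((P.d * ((P.L - 1) / 2) : ℕ) : ℝ) * (4 * ((P.d : ℝ) * (P.L : ℝ)) ^ 2 + 2)) *
          Real.sqrt (∑ q ∈ univ.filter (fun q : Plaq P 0 => Site.tdist q.src (emb (iterBlockOf 1 x)) ≤ 2 * P.d * P.L + P.L),
            (dist1 (GaugeField.plaqHol W q) ^ 2 + dist1 (GaugeField.plaqHol Y q) ^ 2)) := by
  classical
  set y : Site P 1 := iterBlockOf 1 x with hy
  set T := ∑ q ∈ univ.filter (fun q : Plaq P 0 => Site.tdist q.src (emb y) ≤ 2 * P.d * P.L + P.L),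
      (dist1 (GaugeField.plaqHol W q) ^ 2 + dist1 (GaugeField.plaqHol Y q) ^ 2) with hTdef
  set C := 2 * ((P.d : ℝ) * (P.L : ℝ)) ^ 2 + 2 * (6 * ((((P.d + 2) * P.L : ℕ) : ℝ) ^ 2 / 4)) +
      ((P.d * ((P.L - 1) / 2) : ℕ) : ℝ) * (4 * ((P.d : ℝ) * (P.L : ℝ)) ^ 2 + 2) with hCdef
  set α₁ := dist1 (avgFun (expMeanLogSU (n := n)) W ⟨y, μ⟩ * (avgFun (expMeanLogSU (n := n)) Y ⟨y, μ⟩)⁻¹) with hα₁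
  have hC : 0 ≤ C := by positivity
  have hα₁0 : 0 ≤ α₁ := GaugeGroup.dist1_nonneg _
  have hq4 : 0 < (((P.d + 2) * P.L : ℕ) : ℝ) ^ 2 / 4 := by
    have : 0 < (((P.d + 2) * P.L : ℕ) : ℝ) := by
      have h := P.L_pos
      exact_mod_cast Nat.mul_pos (by omega) h
    positivity
  have hWa : ∀ a : ℝ, Real.sqrt T < a → ∀ q : Plaq P 0, Site.tdist q.src (emb y) ≤ 2 * P.d * P.L + P.L → dist1 (GaugeField.plaqHol W q) < a :=
    fun a ha q hq => (dist1_le_sqrt_pairSum W Y (emb y) _ q hq).1.trans_lt ha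
  have hYa : ∀ a : ℝ, Real.sqrt T < a → ∀ q : Plaq P 0, Site.tdist q.src (emb y) ≤ 2 * P.d * P.L + P.L → dist1 (GaugeField.plaqHol Y q) < a :=
    fun a ha q hq => (dist1_le_sqrt_pairSum W Y (emb y) _ q hq).2.trans_lt ha
  -- `dist1 − α₁ ≤ C·a` for every admissible `a`
  have hmain : ∀ a : ℝ, Real.sqrt T < a → a < deltaSU n / ((((P.d + 2) * P.L : ℕ) : ℝ) ^ 2 / 4) →
      dist1 (W ⟨x, μ⟩ * (Y ⟨x, μ⟩)⁻¹) - α₁ ≤ C * a := by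
    intro a ha hat
    have ha0 : 0 ≤ a := (Real.sqrt_nonneg T).trans ha.le
    by_cases hcross : iterBlockOf 1 (x.shift μ) = iterBlockOf 1 x
    · have h := dist1_mul_inv_le_interior_local (k := 1) hk W Y ha0 ha0 hax x μ hcross
        (ball_centre_of_ball W y μ x (Or.inl rfl) (hWa a ha)) (ball_centre_of_ball Y y μ x (Or.inl rfl) (hYa a ha))
      rw [pow_one] at h
      have hrest : 0 ≤ (2 * (6 * ((((P.d + 2) * P.L : ℕ) : ℝ) ^ 2 / 4)) +
          ((P.d * ((P.L - 1) / 2) : ℕ) : ℝ) * (4 * ((P.d : ℝ) * (P.L : ℝ)) ^ 2 + 2)) * a := by positivity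
      calc dist1 (W ⟨x, μ⟩ * (Y ⟨x, μ⟩)⁻¹) - α₁ ≤ ((P.d : ℝ) * (P.L : ℝ)) ^ 2 * (a + a) := by linarith
        _ ≤ C * a := by rw [hCdef]; nlinarith
    · have ht : ((((P.d + 2) * P.L : ℕ) : ℝ) ^ 2 / 4) * a < deltaSU n := by
        rwa [lt_div_iff₀ hq4, mul_comm] at hat
      have h := dist1_cross_le_local hk ha0 W Y hax x μ hcross (hWa a ha) (hYa a ha) ht (le_refl α₁)
      have hrest : 0 ≤ 2 * ((P.d : ℝ) * (P.L : ℝ)) ^ 2 * a := by positivity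
      calc dist1 (W ⟨x, μ⟩ * (Y ⟨x, μ⟩)⁻¹) - α₁ ≤ 2 * (6 * (((((P.d + 2) * P.L : ℕ) : ℝ) ^ 2 / 4) * a)) +
            ((P.d * ((P.L - 1) / 2) : ℕ) : ℝ) * ((4 * ((P.d : ℝ) * (P.L : ℝ)) ^ 2 + 2) * a) := by linarith
        _ ≤ C * a := by rw [hCdef]; nlinarith
  have hle : dist1 (W ⟨x, μ⟩ * (Y ⟨x, μ⟩)⁻¹) - α₁ ≤ C * Real.sqrt T := le_mul_sqrt_of_forall hC hT hmain
  linarith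

/-- ★ **PER BOND, SQUARED**: `dist1(W ℓ·Y ℓ⁻¹)² ≤ 2·mismatch² + 2·C(d,L)²·T_y`. [cite: Balaban1985RegularSpaces, Lemma 1 (1.24)-(1.26) pp.79-80] -/
theorem dist1_mul_inv_sq_le_local (hk : 1 ≤ P.m + P.K) (W Y : GaugeField P 0 (Matrix.specialUnitaryGroup n ℂ))
    (hax : ∀ x : Site P 0, axialT W (embIter 1 (iterBlockOf 1 x)) x = axialT Y (embIter 1 (iterBlockOf 1 x)) x)
    (ℓ : PBond P 0)
    (hT : Real.sqrt (∑ q ∈ univ.filter (fun q : Plaq P 0 => Site.tdist q.src (emb (iterBlockOf 1 ℓ.src)) ≤ 2 * P.d * P.L + P.L),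
        (dist1 (GaugeField.plaqHol W q) ^ 2 + dist1 (GaugeField.plaqHol Y q) ^ 2)) < deltaSU n / ((((P.d + 2) * P.L : ℕ) : ℝ) ^ 2 / 4)) :
    dist1 (W ℓ * (Y ℓ)⁻¹) ^ 2 ≤
      2 * dist1 (avgFun (expMeanLogSU (n := n)) W ⟨iterBlockOf 1 ℓ.src, ℓ.dir⟩ * (avgFun (expMeanLogSU (n := n)) Y ⟨iterBlockOf 1 ℓ.src, ℓ.dir⟩)⁻¹) ^ 2 +
        2 * ((2 * ((P.d : ℝ) * (P.L : ℝ)) ^ 2 + 2 * (6 * ((((P.d + 2) * P.L : ℕ) : ℝ) ^ 2 / 4)) +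
            ((P.d * ((P.L - 1) / 2) : ℕ) : ℝ) * (4 * ((P.d : ℝ) * (P.L : ℝ)) ^ 2 + 2)) ^ 2 *
          ∑ q ∈ univ.filter (fun q : Plaq P 0 => Site.tdist q.src (emb (iterBlockOf 1 ℓ.src)) ≤ 2 * P.d * P.L + P.L),
            (dist1 (GaugeField.plaqHol W q) ^ 2 + dist1 (GaugeField.plaqHol Y q) ^ 2)) := by
  classical
  obtain ⟨x, μ⟩ := ℓ
  have h := dist1_mul_inv_le_mismatch_add_local hk W Y hax x μ hT
  set D := dist1 (W ⟨x, μ⟩ * (Y ⟨x, μ⟩)⁻¹) with hD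
  set A := dist1 (avgFun (expMeanLogSU (n := n)) W ⟨iterBlockOf 1 x, μ⟩ * (avgFun (expMeanLogSU (n := n)) Y ⟨iterBlockOf 1 x, μ⟩)⁻¹) with hA
  set C := 2 * ((P.d : ℝ) * (P.L : ℝ)) ^ 2 + 2 * (6 * ((((P.d + 2) * P.L : ℕ) : ℝ) ^ 2 / 4)) +
      ((P.d * ((P.L - 1) / 2) : ℕ) : ℝ) * (4 * ((P.d : ℝ) * (P.L : ℝ)) ^ 2 + 2) with hCdef
  set T := ∑ q ∈ univ.filter (fun q : Plaq P 0 => Site.tdist q.src (emb (iterBlockOf 1 x)) ≤ 2 * P.d * P.L + P.L),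
      (dist1 (GaugeField.plaqHol W q) ^ 2 + dist1 (GaugeField.plaqHol Y q) ^ 2) with hTdef
  have hT0 : 0 ≤ T := Finset.sum_nonneg fun _ _ => add_nonneg (sq_nonneg _) (sq_nonneg _)
  have hD0 : 0 ≤ D := GaugeGroup.dist1_nonneg _
  have hs : (C * Real.sqrt T) ^ 2 = C ^ 2 * T := by rw [mul_pow, Real.sq_sqrt hT0]
  have h2 : D ^ 2 ≤ (A + C * Real.sqrt T) ^ 2 := pow_le_pow_left₀ hD0 h 2
  nlinarith [sq_nonneg (A - C * Real.sqrt T)]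

/-! ## §2 The sum over the torus -/

/-- At most `d(2dL + 1)^d` fine bonds lie over a coarse bond (crude, volume-free: the fine sources are within `dL` of the block centre). [cite: Balaban1987RG1, (0.3) p.252] -/
theorem card_bonds_over_le (hk : 1 ≤ P.m + P.K) (c : PBond P 1) :
    (univ.filter fun ℓ : PBond P 0 => (⟨iterBlockOf 1 ℓ.src, ℓ.dir⟩ : PBond P 1) = c).card ≤ P.d * (2 * (P.d * P.L) + 1) ^ P.d := by
  classical
  refine le_trans (Finset.card_le_card fun ℓ hℓ => ?_)
    (card_filter_tdist_comp_le (fun ℓ : PBond P 0 => ℓ.src) (m := P.d) card_filter_src_eq_le (emb c.src) (P.d * P.L))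
  rw [Finset.mem_filter] at hℓ ⊢
  refine ⟨Finset.mem_univ _, ?_⟩
  have hsrc : iterBlockOf 1 ℓ.src = c.src := by rw [← hℓ.2]
  have h := tdist_centre_le (k := 1) hk ℓ.src
  rw [pow_one, tdist_comm] at h
  rw [← hsrc]
  exact h

/-- ★★ **CLOSE-PAIR IN `ℓ²`, ONE BLOCK LEVEL, VOLUME-UNIFORM**: `W` comb-axial relative to `Y`, every block ball of the pair under the (0.4) guard ⟹
`Σ_ℓ dist1(W ℓ·Y ℓ⁻¹)² ≤ 2·d(2dL+1)^d·Σ_c dist1(W̄ c·Ȳ c⁻¹)² + 2·C(d,L)²·M(d,L)·Σ_q (dist1(W(∂q))² + dist1(Y(∂q))²)` — constants in `d, L` only.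
[cite: Balaban1985RegularSpaces, Lemma 1 (1.24)-(1.26) pp.79-80; Balaban1985UV3, (12)-(13) p.259] -/
theorem sum_dist1_mul_inv_sq_le (hk : 1 ≤ P.m + P.K) (W Y : GaugeField P 0 (Matrix.specialUnitaryGroup n ℂ))
    (hax : ∀ x : Site P 0, axialT W (embIter 1 (iterBlockOf 1 x)) x = axialT Y (embIter 1 (iterBlockOf 1 x)) x)
    (hT : ∀ y : Site P 1, Real.sqrt (∑ q ∈ univ.filter (fun q : Plaq P 0 => Site.tdist q.src (emb y) ≤ 2 * P.d * P.L + P.L),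
        (dist1 (GaugeField.plaqHol W q) ^ 2 + dist1 (GaugeField.plaqHol Y q) ^ 2)) < deltaSU n / ((((P.d + 2) * P.L : ℕ) : ℝ) ^ 2 / 4)) :
    ∑ ℓ : PBond P 0, dist1 (W ℓ * (Y ℓ)⁻¹) ^ 2 ≤
      2 * ((P.d * (2 * (P.d * P.L) + 1) ^ P.d : ℕ) : ℝ) *
          ∑ c : PBond P 1, dist1 (avgFun (expMeanLogSU (n := n)) W c * (avgFun (expMeanLogSU (n := n)) Y c)⁻¹) ^ 2 +
        2 * (2 * ((P.d : ℝ) * (P.L : ℝ)) ^ 2 + 2 * (6 * ((((P.d + 2) * P.L : ℕ) : ℝ) ^ 2 / 4)) +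
            ((P.d * ((P.L - 1) / 2) : ℕ) : ℝ) * (4 * ((P.d : ℝ) * (P.L : ℝ)) ^ 2 + 2)) ^ 2 *
          (((P.d * (2 * (2 * P.d * P.L + P.L + P.d * P.L) + 1) ^ P.d : ℕ) : ℝ) *
            ∑ q : Plaq P 0, (dist1 (GaugeField.plaqHol W q) ^ 2 + dist1 (GaugeField.plaqHol Y q) ^ 2)) := by
  classical
  set C := 2 * ((P.d : ℝ) * (P.L : ℝ)) ^ 2 + 2 * (6 * ((((P.d + 2) * P.L : ℕ) : ℝ) ^ 2 / 4)) +
      ((P.d * ((P.L - 1) / 2) : ℕ) : ℝ) * (4 * ((P.d : ℝ) * (P.L : ℝ)) ^ 2 + 2) with hCdef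
  set M : ℕ := P.d * (2 * (2 * P.d * P.L + P.L + P.d * P.L) + 1) ^ P.d with hMdef
  set NB : ℕ := P.d * (2 * (P.d * P.L) + 1) ^ P.d with hNBdef
  set f : Plaq P 0 → ℝ := fun q => dist1 (GaugeField.plaqHol W q) ^ 2 + dist1 (GaugeField.plaqHol Y q) ^ 2 with hfdef
  set g : PBond P 1 → ℝ := fun c => dist1 (avgFun (expMeanLogSU (n := n)) W c * (avgFun (expMeanLogSU (n := n)) Y c)⁻¹) ^ 2 with hgdef
  have hf0 : ∀ q, 0 ≤ f q := fun q => add_nonneg (sq_nonneg _) (sq_nonneg _)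
  have hg0 : ∀ c, 0 ≤ g c := fun c => sq_nonneg _
  -- per bond
  have hbond : ∀ ℓ : PBond P 0, dist1 (W ℓ * (Y ℓ)⁻¹) ^ 2 ≤
      2 * g ⟨iterBlockOf 1 ℓ.src, ℓ.dir⟩ +
        2 * C ^ 2 * ∑ q ∈ univ.filter (fun q : Plaq P 0 => Site.tdist q.src (emb (iterBlockOf 1 ℓ.src)) ≤ 2 * P.d * P.L + P.L), f q :=
    fun ℓ => by
      have h := dist1_mul_inv_sq_le_local hk W Y hax ℓ (hT _)
      simpa only [hgdef, hfdef, hCdef, mul_assoc] using h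
  -- the mismatch channel: fibrewise over the coarse bonds
  have hmis : ∑ ℓ : PBond P 0, g ⟨iterBlockOf 1 ℓ.src, ℓ.dir⟩ ≤ (NB : ℝ) * ∑ c : PBond P 1, g c := by
    rw [Finset.sum_comp g (fun ℓ : PBond P 0 => (⟨iterBlockOf 1 ℓ.src, ℓ.dir⟩ : PBond P 1))]
    calc ∑ c ∈ univ.image (fun ℓ : PBond P 0 => (⟨iterBlockOf 1 ℓ.src, ℓ.dir⟩ : PBond P 1)),
          (univ.filter fun ℓ : PBond P 0 => (⟨iterBlockOf 1 ℓ.src, ℓ.dir⟩ : PBond P 1) = c).card • g c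
        ≤ ∑ c ∈ univ.image (fun ℓ : PBond P 0 => (⟨iterBlockOf 1 ℓ.src, ℓ.dir⟩ : PBond P 1)), (NB : ℝ) * g c := by
          refine Finset.sum_le_sum fun c _ => ?_
          rw [nsmul_eq_mul]
          refine mul_le_mul_of_nonneg_right ?_ (hg0 c)
          exact_mod_cast card_bonds_over_le hk c
      _ ≤ ∑ c : PBond P 1, (NB : ℝ) * g c :=
          Finset.sum_le_sum_of_subset_of_nonneg (Finset.subset_univ _) fun c _ _ => mul_nonneg (Nat.cast_nonneg _) (hg0 c)
      _ = (NB : ℝ) * ∑ c : PBond P 1, g c := by rw [Finset.mul_sum]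
  -- the plaquette channel: exchange and multiplicity (as in the flat file)
  have hex : ∑ ℓ : PBond P 0, ∑ q ∈ univ.filter (fun q : Plaq P 0 => Site.tdist q.src (emb (iterBlockOf 1 ℓ.src)) ≤ 2 * P.d * P.L + P.L), f q
      ≤ (M : ℝ) * ∑ q : Plaq P 0, f q := by
    calc ∑ ℓ : PBond P 0, ∑ q ∈ univ.filter (fun q : Plaq P 0 => Site.tdist q.src (emb (iterBlockOf 1 ℓ.src)) ≤ 2 * P.d * P.L + P.L), f q
        = ∑ ℓ : PBond P 0, ∑ q : Plaq P 0,
            (if Site.tdist q.src (emb (iterBlockOf 1 ℓ.src)) ≤ 2 * P.d * P.L + P.L then f q else 0) := by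
          refine Finset.sum_congr rfl fun ℓ _ => ?_
          rw [Finset.sum_filter]
      _ = ∑ q : Plaq P 0, ∑ ℓ : PBond P 0,
            (if Site.tdist q.src (emb (iterBlockOf 1 ℓ.src)) ≤ 2 * P.d * P.L + P.L then f q else 0) := Finset.sum_comm
      _ = ∑ q : Plaq P 0,
            ((univ.filter fun ℓ : PBond P 0 => Site.tdist q.src (emb (iterBlockOf 1 ℓ.src)) ≤ 2 * P.d * P.L + P.L).card : ℝ) * f q := by
          refine Finset.sum_congr rfl fun q _ => ?_
          rw [← Finset.sum_filter, Finset.sum_const, nsmul_eq_mul]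
      _ ≤ ∑ q : Plaq P 0, (M : ℝ) * f q := by
          refine Finset.sum_le_sum fun q _ => mul_le_mul_of_nonneg_right ?_ (hf0 q)
          exact_mod_cast card_bonds_near_le hk q
      _ = (M : ℝ) * ∑ q : Plaq P 0, f q := by rw [Finset.mul_sum]
  have hC2 : 0 ≤ 2 * C ^ 2 := by positivity
  calc ∑ ℓ : PBond P 0, dist1 (W ℓ * (Y ℓ)⁻¹) ^ 2
      ≤ ∑ ℓ : PBond P 0, (2 * g ⟨iterBlockOf 1 ℓ.src, ℓ.dir⟩ +
          2 * C ^ 2 * ∑ q ∈ univ.filter (fun q : Plaq P 0 => Site.tdist q.src (emb (iterBlockOf 1 ℓ.src)) ≤ 2 * P.d * P.L + P.L), f q) :=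
        Finset.sum_le_sum fun ℓ _ => hbond ℓ
    _ = 2 * ∑ ℓ : PBond P 0, g ⟨iterBlockOf 1 ℓ.src, ℓ.dir⟩ +
          2 * C ^ 2 * ∑ ℓ : PBond P 0, ∑ q ∈ univ.filter (fun q : Plaq P 0 => Site.tdist q.src (emb (iterBlockOf 1 ℓ.src)) ≤ 2 * P.d * P.L + P.L), f q := by
        rw [Finset.sum_add_distrib, Finset.mul_sum, Finset.mul_sum]
    _ ≤ 2 * ((NB : ℝ) * ∑ c : PBond P 1, g c) + 2 * C ^ 2 * ((M : ℝ) * ∑ q : Plaq P 0, f q) := by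
        have h1 := mul_le_mul_of_nonneg_left hmis (show (0 : ℝ) ≤ 2 by norm_num)
        have h2 := mul_le_mul_of_nonneg_left hex hC2
        linarith
    _ = _ := by rw [hNBdef, hMdef]; push_cast; ring

end Summit.QuantumFields.YangMills.Theorems.FluctuationComparisonRegPrIntLS2BetaOneStepL2ClosePair

end
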